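import Summits.NavierStokesRegularity.NavierStokesRegularity.Theorems.HubbleDynamoNoSelfExcitedDynamoStubSingleTimeSwitchOff
import Summits.NavierStokesRegularity.NavierStokesRegularity.Theorems.HubbleDynamoNoSelfExcitedDynamoStubAlphaLimit
import Summits.NavierStokesRegularity.NavierStokesRegularity.Theorems.HubbleDynamoNoSelfExcitedDynamoReduction
import HarnessLib

/-!
# Crux `NoSelfExcitedDynamo` (stmt-NavierStokesRegularity-1934), line `registered` v6: the crux IS
  pointwise Type-I blow-up exclusion

Theorems file (lands `--supports stmt-NavierStokesRegularity-1934`; registered sub-goals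
`eternalLiouville_of_noTypeIProfile`, `noSelfExcitedDynamo_of_noTypeIProfile`; the converse
`noTypeIProfile_of_noSelfExcitedDynamo` and the reading `noTypeIProfile_iff_switchOff` are in
`HubbleDynamoNoSelfExcitedDynamoNoTypeIProfileConverse.lean`). It makes durable the closed composition of the lead's
skeleton v6 (`Cruxes/NoSelfExcitedDynamo/Lines/birth.lean`) and records the EQUIVALENCE

  `NoSelfExcitedDynamo` ⇔ (G) every eternal classical solution `(W, Q)` of Leray's backward system
  `∂ₛW + ½W + ½(y·∇)W + (W·∇)W + ∇Q = ΔW`, `div W = 0` on `ℝ × ℝ³` in the uniform profile class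
  becomes uniformly `δ`-small at some similarity time, for every `δ > 0`

— by `stub_singleTimeSwitchOff` (p156442) (G) says that every eternal profile flow SWITCHES OFF,
i.e. that no Type-I ancient field of the profile class is singular at its vertex: the open content of
the crux is exactly the exclusion of POINTWISE-TYPE-I BLOW-UP PROFILES.

* `eternalLiouville_of_noTypeIProfile`: (G) ⇒ every eternal profile-class solution vanishes. If the
  amplitude of `U` is `δ`-small at arbitrarily early times for every `δ > 0`,
  `stub_pastSmallnessLiouville` applies; otherwise some `δ > 0` is an amplitude floor on a past
  half-line, `stub_alphaLimit` realises it at every time by an eternal profile-class `W`, and (G)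
  makes `W` dip below `δ` — contradiction.
* `noSelfExcitedDynamo_of_noTypeIProfile`: (G) ⇒ crux (`stub_eternalReduction`, p151325).
* converse crux ⇒ (G): `noTypeIProfile_of_noSelfExcitedDynamo` (file `…NoTypeIProfileConverse.lean`).
-/

noncomputable section

-- the mandated stub namespace repeats `NavierStokesRegularity` (tree precedent for this crux's stubs)
set_option linter.dupNamespace false

namespace Summit.NavierStokesRegularity.NavierStokesRegularity.Theorems.NoSelfExcitedDynamo.Registered

open Set MeasureTheory Filter Topology
open scoped ContDiff
open Literature.Analysis.FluidPDE

/-- **Eternal Liouville from Type-I blow-up exclusion** (registered sub-goal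
`eternalLiouville_of_noTypeIProfile`): if every eternal profile-class solution of Leray's backward
system becomes uniformly `δ`-small at some similarity time for every `δ > 0`, then every eternal
profile-class solution vanishes identically (`stub_pastSmallnessLiouville` if the amplitude is small
at arbitrarily early times; else `stub_alphaLimit` produces an eternal flow with a permanent
amplitude floor, contradicting the hypothesis). -/
theorem eternalLiouville_of_noTypeIProfile :
    (∀ (W : ℝ → EuclideanSpace ℝ (Fin 3) → EuclideanSpace ℝ (Fin 3)) (Q : ℝ → EuclideanSpace ℝ (Fin 3) → ℝ),
      IsBackwardLeraySolutionOn univ 1 W Q →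
      (∀ k : ℕ, ∃ K : ℝ, ∀ s y, (1 + ‖y‖) ^ (k + 1) * ‖iteratedFDeriv ℝ k (W s) y‖ ≤ K) →
      ∀ δ : ℝ, 0 < δ → ∃ s : ℝ, ∀ y, ‖W s y‖ < δ) →
    ∀ (U : ℝ → EuclideanSpace ℝ (Fin 3) → EuclideanSpace ℝ (Fin 3)) (P : ℝ → EuclideanSpace ℝ (Fin 3) → ℝ),
      IsBackwardLeraySolutionOn univ 1 U P →
      (∀ k : ℕ, ∃ K : ℝ, ∀ s y, (1 + ‖y‖) ^ (k + 1) * ‖iteratedFDeriv ℝ k (U s) y‖ ≤ K) →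
      ∀ s y, U s y = 0 := by
  intro hG U P hL hprof
  refine stub_pastSmallnessLiouville U P hL hprof fun δ hδ S => ?_
  by_contra hcon
  push Not at hcon
  obtain ⟨W, Q, hW, hWprof, hfloor⟩ :=
    stub_alphaLimit U P hL hprof δ S fun s hs => (hcon s hs).imp fun y hy => hy.le
  obtain ⟨s, hs⟩ := hG W Q hW hWprof δ hδ
  obtain ⟨y, hy⟩ := hfloor s
  exact absurd (hs y) (not_lt.2 hy)

/-- **The crux from Type-I blow-up exclusion** (registered sub-goal
`noSelfExcitedDynamo_of_noTypeIProfile`; the composition of the line's skeleton v6, made durable):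
hypothesis (G) implies `NoSelfExcitedDynamo` (conclusion written unfolded), by
`stub_eternalReduction` (p151325) — whose switch-off clause is not even needed — and
`eternalLiouville_of_noTypeIProfile`. -/
theorem noSelfExcitedDynamo_of_noTypeIProfile :
    (∀ (W : ℝ → EuclideanSpace ℝ (Fin 3) → EuclideanSpace ℝ (Fin 3)) (Q : ℝ → EuclideanSpace ℝ (Fin 3) → ℝ),
      IsBackwardLeraySolutionOn univ 1 W Q →
      (∀ k : ℕ, ∃ K : ℝ, ∀ s y, (1 + ‖y‖) ^ (k + 1) * ‖iteratedFDeriv ℝ k (W s) y‖ ≤ K) →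
      ∀ δ : ℝ, 0 < δ → ∃ s : ℝ, ∀ y, ‖W s y‖ < δ) →
    ∀ u : ℝ → EuclideanSpace ℝ (Fin 3) → EuclideanSpace ℝ (Fin 3),
      IsBoundedAncientMildSolution 1 u →
      (∀ t < 0, AEStronglyMeasurable (u t) volume) → (∃ C : ℝ, HasTypeIDecay C u) →
      ∀ t < 0, u t =ᵐ[volume] (0 : EuclideanSpace ℝ (Fin 3) → EuclideanSpace ℝ (Fin 3)) :=
  fun hG => stub_eternalReduction fun U P hL hprof _ => eternalLiouville_of_noTypeIProfile hG U P hL hprof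

end Summit.NavierStokesRegularity.NavierStokesRegularity.Theorems.NoSelfExcitedDynamo.Registered

end
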